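import Summits.CriticalPhenomena.PercolationContinuityZ3.Theorems.PercNearOneGluingNoHeavyLowerTailConditionalSelectionHolds
import Summits.CriticalPhenomena.PercolationContinuityZ3.Theorems.PercNearOneGluingNoHeavyLowerTailCumulativeIsolation
import HarnessLib

/-!
# The SELECTION PRINCIPLE for a general increasing target, and the block form of hp-8's pattern-lightest stub

Support file (`--supports stmt-CriticalPhenomena-4575`), prover `prim-ineq-gen-6` (gen 10; memo FINDING-G10 §5).  No
definitions, no named facts, no sorries; standard axioms.

`CSLHolds.selection_le`: for every monotone cluster target `T`, `μ({o ↔ A} ∩ {¬T(C_o)}) ≤ Σ_a μ(V_a)·μ(¬T(C_a))`, where `V_a` is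
the worst-first selection event of `…ConditionalSelectionHolds.lean` (prim-hp-4's SEL-𝒯 for every increasing target; the
companion `…CovarianceGluingHolds.lean` is the instance `T(K) = (c ∈ K)`).  Proof: Kozma–Nitzan's Conjecture 4
(`Q7Psi.kn_conj4_designated`) for `F(K) = 1{T K} + max_{x ∈ K∩A} μ(¬T(C_x))` and Harris.

`CSLHolds.stub_blockLightest`: the registered stub of prim-hp-8 (PL-block, "strengthening of CIL_j with the witness chosen per
BLOCK of the observer"), verbatim: `∃ sel, (∀ B, sel B ∈ B) ∧ μ(1 ≤ N ≤ j) ≤ Σ_{∅ ≠ B ⊆ A} μ(π(o) = B)·μ(|π(sel B)| ≤ j)`.  With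
the worst-first selector `sel B :=` the `δ`-maximal member of `B` (`δ_x = μ(|π(x)| ≤ j)`), the right-hand side is
`Σ_a μ(V_a)·δ_a` and the statement is `selection_le` at the block target `T(K) = (j < |K ∩ A|)`.  (hp-8's intended selector —
the LIGHTEST member of each block — gives a stronger inequality that is not claimed here.)
[cite: KozmaNitzan2024, Conjecture 4 (p. 32), Lemma 2 (p. 6)] [cite: Harris1960]
-/

noncomputable section

namespace Summit.CriticalPhenomena.PercolationContinuityZ3.Theorems

open MeasureTheory Set Literature.Probability.LatticeModels Literature.Probability.Percolation
open scoped Classical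

namespace CSLHolds

variable {n : ℕ}

/-- **The SELECTION PRINCIPLE for a general increasing cluster target** (prim-hp-4's SEL-𝒯; the unweighted companion
of the conditional selection lemma): with `δ_a = μ(¬T(C_a))`, `𝔸 = {o ↔ A}` and `V_a = {a is the worst-ranked relay of
o's block}` (`δ`-maximal, smallest index among ties),  `μ(𝔸 ∩ {¬T(C_o)}) ≤ Σ_{a ∈ A} μ(V_a)·δ_a = E[1_𝔸 · max_{x ∈ π(o)} δ_x]`.
Kozma–Nitzan's Conjecture 4 (`Q7Psi.kn_conj4_designated`) for `F(K) = 1{T K} + max_{x ∈ K∩A} δ_x`, plus Harris. [this work]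
[cite: KozmaNitzan2024, Conjecture 4 (p. 32)] [cite: Harris1960] -/
theorem selection_le (w : Sym2 (Fin n) → unitInterval) (A : Finset (Fin n)) (o : Fin n)
    (T : Set (Fin n) → Prop) (hT : ∀ K K' : Set (Fin n), K ⊆ K' → T K → T K') :
    (prodBernoulli w).real ((⋃ a ∈ A, (openConn o a : Set (BondConfig (Fin n)))) ∩
        {ω : BondConfig (Fin n) | ¬ T (openCluster ω o)}) ≤
      ∑ a ∈ A, (prodBernoulli w).real
          {ω : BondConfig (Fin n) | ω ∈ openConn o a ∧
            ∀ x ∈ A, ω ∈ openConn o x →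
              ((prodBernoulli w).real {ω : BondConfig (Fin n) | ¬ T (openCluster ω x)} <
                  (prodBernoulli w).real {ω : BondConfig (Fin n) | ¬ T (openCluster ω a)} ∨
                ((prodBernoulli w).real {ω : BondConfig (Fin n) | ¬ T (openCluster ω x)} =
                    (prodBernoulli w).real {ω : BondConfig (Fin n) | ¬ T (openCluster ω a)} ∧ a ≤ x))} *
        (prodBernoulli w).real {ω : BondConfig (Fin n) | ¬ T (openCluster ω a)} := by
  -- the target events are increasing
  have hTup : ∀ a : Fin n, IsUpperSet {ω : BondConfig (Fin n) | T (openCluster ω a)} := by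
    intro a ω ω' hle hω
    exact hT _ _ (fun y hy => isUpperSet_openConn a y hle hy) hω
  set μ := prodBernoulli w with hμ
  haveI : IsProbabilityMeasure μ := by rw [hμ]; infer_instance
  have hmeas : ∀ S : Set (BondConfig (Fin n)), MeasurableSet S := fun _ => MeasurableSet.of_discrete
  have hint : ∀ (g : BondConfig (Fin n) → ℝ), Integrable g μ := fun g => Integrable.of_finite
  have hintr : ∀ (g : BondConfig (Fin n) → ℝ) (S : Set (BondConfig (Fin n))), Integrable g (μ.restrict S) :=
    fun g S => Integrable.of_finite
  set δ : Fin n → ℝ := fun a => μ.real {ω : BondConfig (Fin n) | ¬ T (openCluster ω a)} with hδ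
  set U : Set (BondConfig (Fin n)) := ⋃ a ∈ A, (openConn o a : Set (BondConfig (Fin n))) with hU
  set V : Fin n → Set (BondConfig (Fin n)) := fun a =>
    {ω : BondConfig (Fin n) | ω ∈ openConn o a ∧
      ∀ x ∈ A, ω ∈ openConn o x → (δ x < δ a ∨ (δ x = δ a ∧ a ≤ x))} with hV
  change μ.real (U ∩ {ω : BondConfig (Fin n) | ¬ T (openCluster ω o)}) ≤ ∑ a ∈ A, μ.real (V a) * δ a
  have hδ0 : ∀ a, 0 ≤ δ a := fun a => measureReal_nonneg
  have hcompl : ∀ a : Fin n, μ.real {ω : BondConfig (Fin n) | T (openCluster ω a)} = 1 - δ a := by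
    intro a
    have h := probReal_compl_eq_one_sub (μ := μ) (s := {ω : BondConfig (Fin n) | T (openCluster ω a)}) (hmeas _)
    have hc : ({ω : BondConfig (Fin n) | T (openCluster ω a)} : Set (BondConfig (Fin n)))ᶜ =
        {ω : BondConfig (Fin n) | ¬ T (openCluster ω a)} := Set.ext fun _ => Iff.rfl
    rw [hc] at h
    change δ a = 1 - μ.real {ω : BondConfig (Fin n) | T (openCluster ω a)} at h
    linarith
  rcases A.eq_empty_or_nonempty with hAe | hAne
  · have hUe : U = ∅ := by rw [hU, hAe]; simp
    rw [hAe, Finset.sum_empty, hUe, Set.empty_inter, measureReal_empty]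
  obtain ⟨a₁, ha₁, hworst₁⟩ := worst_exists δ A hAne
  have hle₁ : ∀ x ∈ A, δ x ≤ δ a₁ := fun x hx => by
    rcases hworst₁ x hx with h | ⟨h, _⟩
    · exact h.le
    · exact h.le
  -- `Mx(S) = max_{x ∈ S ∩ A} δ_x` (or `0`)
  set Mx : Set (Fin n) → ℝ := fun S =>
    if h : (A.filter fun x => x ∈ S).Nonempty then (A.filter fun x => x ∈ S).sup' h δ else 0 with hMx
  have hMx0 : ∀ S, 0 ≤ Mx S := by
    intro S
    by_cases hne : (A.filter fun x => x ∈ S).Nonempty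
    · simp only [hMx, dif_pos hne]
      obtain ⟨x, hx⟩ := hne
      exact (hδ0 x).trans (Finset.le_sup' δ hx)
    · simp only [hMx, dif_neg hne]; exact le_refl _
  have hMx1 : ∀ (S : Set (Fin n)), ∀ a ∈ A, a ∈ S → δ a ≤ Mx S := by
    intro S a ha haS
    have hmem : a ∈ A.filter fun x => x ∈ S := Finset.mem_filter.2 ⟨ha, haS⟩
    have hne : (A.filter fun x => x ∈ S).Nonempty := ⟨a, hmem⟩
    simp only [hMx, dif_pos hne]
    exact Finset.le_sup' δ hmem
  have hMx2 : ∀ S : Set (Fin n), Mx S ≤ δ a₁ := by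
    intro S
    by_cases hne : (A.filter fun x => x ∈ S).Nonempty
    · simp only [hMx, dif_pos hne]
      exact Finset.sup'_le hne δ fun x hx => hle₁ x (Finset.mem_filter.1 hx).1
    · simp only [hMx, dif_neg hne]; exact hδ0 a₁
  have hMx3 : ∀ S T : Set (Fin n), S ⊆ T → Mx S ≤ Mx T := by
    intro S T hST
    by_cases hneS : (A.filter fun x => x ∈ S).Nonempty
    · have hsub : (A.filter fun x => x ∈ S) ⊆ (A.filter fun x => x ∈ T) :=
        Finset.monotone_filter_right A fun _ _ hx => hST hx
      have hneT : (A.filter fun x => x ∈ T).Nonempty := hneS.mono hsub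
      simp only [hMx, dif_pos hneS, dif_pos hneT]
      exact Finset.sup'_le hneS δ fun x hx => Finset.le_sup' δ (hsub hx)
    · simp only [hMx, dif_neg hneS]; exact hMx0 T
  -- the functional
  set F : Set (Fin n) → ℝ := fun S => (if T S then (1 : ℝ) else 0) + Mx S with hF
  have hFmono : ∀ S S' : Set (Fin n), S ⊆ S' → F S ≤ F S' := by
    intro S S' hST
    have h1 : (if T S then (1 : ℝ) else 0) ≤ (if T S' then (1 : ℝ) else 0) := by
      by_cases hcS : T S
      · rw [if_pos hcS, if_pos (hT S S' hST hcS)]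
      · rw [if_neg hcS]; by_cases hcT : T S'
        · rw [if_pos hcT]; exact zero_le_one
        · rw [if_neg hcT]
    simp only [hF]
    linarith [hMx3 S S' hST]
  -- `∫ F(C a) = μ(T(C a)) + ∫ Mx(C a)`
  have hsplit : ∀ (a : Fin n) (E : Set (BondConfig (Fin n))),
      ∫ ω in E, F (openCluster ω a) ∂μ =
        μ.real ({ω : BondConfig (Fin n) | T (openCluster ω a)} ∩ E) + ∫ ω in E, Mx (openCluster ω a) ∂μ := by
    intro a E
    simp only [hF]
    rw [integral_add (hintr _ _) (hintr _ _)]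
    congr 1
    have e : (fun ω : BondConfig (Fin n) => if T (openCluster ω a) then (1 : ℝ) else 0) =
        {ω : BondConfig (Fin n) | T (openCluster ω a)}.indicator 1 := by
      funext ω
      by_cases hω : ω ∈ {ω : BondConfig (Fin n) | T (openCluster ω a)}
      · rw [Set.indicator_of_mem hω, Pi.one_apply, if_pos (by simpa only [Set.mem_setOf_eq] using hω)]
      · rw [Set.indicator_of_notMem hω, if_neg (by simpa only [Set.mem_setOf_eq] using hω)]
    rw [e, integral_indicator_one (hmeas _), measureReal_restrict_apply (hmeas _)]
  -- designated least-mean relay: `∫ F(C a₁) ≤ 1 ≤ ∫ F(C a)`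
  have hlow : ∀ a ∈ A, 1 ≤ ∫ ω, F (openCluster ω a) ∂μ := by
    intro a ha
    rw [← setIntegral_univ, hsplit a Set.univ, Set.inter_univ, hcompl a]
    have hI : ∫ ω in Set.univ, (fun _ => δ a) ω ∂μ ≤ ∫ ω in Set.univ, Mx (openCluster ω a) ∂μ :=
      setIntegral_mono (hintr _ _) (hintr _ _) fun ω => hMx1 _ a ha (mem_openCluster_self ω a)
    rw [setIntegral_const, smul_eq_mul, probReal_univ, one_mul] at hI
    linarith
  have hup : ∫ ω, F (openCluster ω a₁) ∂μ ≤ 1 := by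
    rw [← setIntegral_univ, hsplit a₁ Set.univ, Set.inter_univ, hcompl a₁]
    have hI : ∫ ω in Set.univ, Mx (openCluster ω a₁) ∂μ ≤ ∫ ω in Set.univ, (fun _ => δ a₁) ω ∂μ :=
      setIntegral_mono (hintr _ _) (hintr _ _) fun ω => hMx2 _
    rw [setIntegral_const, smul_eq_mul, probReal_univ, one_mul] at hI
    linarith
  have hmin : ∀ a ∈ A, ∫ ω, F (openCluster ω a₁) ∂μ ≤ ∫ ω, F (openCluster ω a) ∂μ :=
    fun a ha => hup.trans (hlow a ha)
  -- Conjecture 4, designated form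
  have key := Q7Psi.kn_conj4_designated w A o a₁ F hFmono ha₁ hmin
  rw [← hμ] at key
  change ∫ ω in U, F (openCluster ω a₁) ∂μ ≤ ∫ ω in U, F (openCluster ω o) ∂μ at key
  rw [hsplit a₁ U, hsplit o U] at key
  -- observer side: `∫_U Mx(C_o) ≤ Σ_a μ(V_a) δ_a`
  have hobs : ∫ ω in U, Mx (openCluster ω o) ∂μ ≤ ∑ a ∈ A, μ.real (V a) * δ a := by
    rw [← integral_indicator (hmeas U)]
    have hpt : ∀ ω, U.indicator (fun ω => Mx (openCluster ω o)) ω ≤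
        ∑ a ∈ A, (V a).indicator (fun _ => δ a) ω := by
      intro ω
      have hnn : 0 ≤ ∑ a ∈ A, (V a).indicator (fun _ => δ a) ω :=
        Finset.sum_nonneg fun a _ => Set.indicator_nonneg (fun _ _ => hδ0 a) _
      by_cases hωU : ω ∈ U
      · rw [Set.indicator_of_mem hωU]
        -- the worst relay of `π(o)` exists
        set B := A.filter fun x => ω ∈ openConn o x with hB
        have hBne : B.Nonempty := by
          obtain ⟨a, ha, h⟩ := Set.mem_iUnion₂.1 hωU
          exact ⟨a, Finset.mem_filter.2 ⟨ha, h⟩⟩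
        obtain ⟨a, haB, hwa⟩ := worst_exists δ B hBne
        have haA : a ∈ A := (Finset.mem_filter.1 haB).1
        have hoa : ω ∈ openConn o a := (Finset.mem_filter.1 haB).2
        have hωV : ω ∈ V a := ⟨hoa, fun x hx hox => hwa x (Finset.mem_filter.2 ⟨hx, hox⟩)⟩
        have hterm : δ a ≤ ∑ x ∈ A, (V x).indicator (fun _ => δ x) ω := by
          have := Finset.single_le_sum (f := fun x => (V x).indicator (fun _ => δ x) ω)
            (fun x _ => Set.indicator_nonneg (fun _ _ => hδ0 x) _) haA
          rw [Set.indicator_of_mem hωV] at this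
          exact this
        refine le_trans ?_ hterm
        -- `Mx(C_o) ≤ δ_a`
        have hBeq : (A.filter fun x => x ∈ openCluster ω o) = B := CIL.filter_mem_openCluster A ω o
        have hne : (A.filter fun x => x ∈ openCluster ω o).Nonempty := by rw [hBeq]; exact hBne
        simp only [hMx, dif_pos hne]
        refine Finset.sup'_le hne δ fun x hx => ?_
        rw [hBeq] at hx
        rcases hwa x hx with h | ⟨h, _⟩
        · exact h.le
        · exact h.le
      · rw [Set.indicator_of_notMem hωU]; exact hnn
    have hI := integral_mono (hint _) (hint _) hpt
    rw [integral_sum_indicator] at hI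
    exact hI
  -- relay side: `∫_U Mx(C a₁) ≥ δ a₁ μ(U)`
  have hrel : δ a₁ * μ.real U ≤ ∫ ω in U, Mx (openCluster ω a₁) ∂μ := by
    have hI : ∫ ω in U, (fun _ => δ a₁) ω ∂μ ≤ ∫ ω in U, Mx (openCluster ω a₁) ∂μ :=
      setIntegral_mono (hintr _ _) (hintr _ _) fun ω => hMx1 _ a₁ ha₁ (mem_openCluster_self ω a₁)
    rw [setIntegral_const, smul_eq_mul] at hI
    linarith
  -- Harris: `{o ↔ A}` and `{a₁ ↔ c}` increasing
  have hharris : μ.real U * μ.real {ω : BondConfig (Fin n) | T (openCluster ω a₁)} ≤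
      μ.real (U ∩ {ω : BondConfig (Fin n) | T (openCluster ω a₁)}) :=
    prodBernoulli_harris w (QuantGapPlusOne.isUpperSet_touch A o) (hTup a₁) (hmeas _) (hmeas _)
  -- assemble: `μ(U ∩ ¬T(C_o)) = μ(U) - μ(T(C_o) ∩ U) ≤ Σ μ(V_a) δ_a`
  have hUsplit := measureReal_inter_add_sdiff (μ := μ) (s := U)
    (t := {ω : BondConfig (Fin n) | T (openCluster ω o)}) (hmeas _) (measure_ne_top μ _)
  have hdiff : U \ {ω : BondConfig (Fin n) | T (openCluster ω o)} =
      U ∩ {ω : BondConfig (Fin n) | ¬ T (openCluster ω o)} := by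
    ext ω; simp only [Set.mem_sdiff, Set.mem_inter_iff, Set.mem_setOf_eq]
  rw [hdiff] at hUsplit
  rw [Set.inter_comm {ω : BondConfig (Fin n) | T (openCluster ω a₁)} U] at key
  rw [Set.inter_comm {ω : BondConfig (Fin n) | T (openCluster ω o)} U] at key
  rw [hcompl a₁] at hharris
  linarith


/-- Integral of a finite sum of weighted indicators, any index type. [folklore] -/
theorem integral_sum_indicator' {ι : Type*} (μ : Measure (BondConfig (Fin n))) [IsFiniteMeasure μ]
    (I : Finset ι) (g : ι → ℝ) (S : ι → Set (BondConfig (Fin n))) :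
    ∫ ω, (∑ i ∈ I, (S i).indicator (fun _ => g i) ω) ∂μ = ∑ i ∈ I, μ.real (S i) * g i := by
  rw [integral_finsetSum _ (fun i _ => Integrable.of_finite)]
  refine Finset.sum_congr rfl fun i _ => ?_
  rw [integral_indicator_const (g i) MeasurableSet.of_discrete, smul_eq_mul]

/-- **Registered stub `stub_blockLightest` of prim-hp-8 (PL-block), verbatim**, with the WORST-FIRST selector: for
`δ_x = μ(|π(x)| ≤ j)` and `sel B` the `δ`-maximal member of `B` (smallest index among ties),
`μ(1 ≤ N ≤ j) ≤ Σ_{∅ ≠ B ⊆ A} μ(π(o) = B)·μ(|π(sel B)| ≤ j) = E[1_{o↔A} δ_{sel π(o)}]`, which is `selection_le` at the block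
target `T(K) = (j < |K ∩ A|)`. [this work] [cite: KozmaNitzan2024, Conjecture 4 (p. 32), Lemma 2 (p. 6)] -/
theorem stub_blockLightest :
    ∀ (n : ℕ) (w : Sym2 (Fin n) → unitInterval) (A : Finset (Fin n)) (o : Fin n) (j : ℕ), o ∉ A →
      ∃ sel : Finset (Fin n) → Fin n, (∀ B ∈ A.powerset.erase ∅, sel B ∈ B) ∧
        (Literature.Probability.LatticeModels.prodBernoulli w).real
            {ω : Literature.Probability.Percolation.BondConfig (Fin n) |
              1 ≤ (A.filter fun x => ω ∈ Literature.Probability.Percolation.openConn o x).card ∧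
                (A.filter fun x => ω ∈ Literature.Probability.Percolation.openConn o x).card ≤ j} ≤
          ∑ B ∈ A.powerset.erase ∅,
            (Literature.Probability.LatticeModels.prodBernoulli w).real
                {ω : Literature.Probability.Percolation.BondConfig (Fin n) |
                  (A.filter fun x => ω ∈ Literature.Probability.Percolation.openConn o x) = B} *
              (Literature.Probability.LatticeModels.prodBernoulli w).real
                {ω : Literature.Probability.Percolation.BondConfig (Fin n) |
                  (A.filter fun x => ω ∈ Literature.Probability.Percolation.openConn (sel B) x).card ≤ j} := by
  intro n w A o j _
  set μ := prodBernoulli w with hμ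
  haveI : IsProbabilityMeasure μ := by rw [hμ]; infer_instance
  have hmeas : ∀ S : Set (BondConfig (Fin n)), MeasurableSet S := fun _ => MeasurableSet.of_discrete
  have hint : ∀ (g : BondConfig (Fin n) → ℝ), Integrable g μ := fun g => Integrable.of_finite
  -- the block target and its detachments
  set T : Set (Fin n) → Prop := fun K => j < (A.filter fun y => y ∈ K).card with hT
  have hTmono : ∀ K K' : Set (Fin n), K ⊆ K' → T K → T K' := by
    intro K K' hKK' hK
    simp only [hT] at hK ⊢
    exact lt_of_lt_of_le hK (Finset.card_le_card (Finset.monotone_filter_right A fun _ _ hy => hKK' hy))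
  set δ : Fin n → ℝ := fun a => μ.real {ω : BondConfig (Fin n) | ¬ T (openCluster ω a)} with hδ
  have hδR : ∀ a : Fin n, δ a =
      μ.real {ω : BondConfig (Fin n) | (A.filter fun x => ω ∈ openConn a x).card ≤ j} := by
    intro a
    simp only [hδ, hT]
    congr 1
    ext ω
    simp only [Set.mem_setOf_eq, not_lt, CIL.filter_mem_openCluster]
  -- the worst-first selector
  set sel : Finset (Fin n) → Fin n := fun B =>
    if h : B.Nonempty then Classical.choose (worst_exists δ B h) else o with hsel
  have hsel_spec : ∀ B : Finset (Fin n), ∀ hB : B.Nonempty,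
      sel B ∈ B ∧ ∀ x ∈ B, δ x < δ (sel B) ∨ (δ x = δ (sel B) ∧ sel B ≤ x) := by
    intro B hB
    simp only [hsel, dif_pos hB]
    exact Classical.choose_spec (worst_exists δ B hB)
  refine ⟨sel, fun B hB => ?_, ?_⟩
  · have hBne : B.Nonempty := Finset.nonempty_iff_ne_empty.2 (Finset.mem_erase.1 hB).1
    exact (hsel_spec B hBne).1
  -- the selection principle at the block target
  have hSEL := selection_le w A o T hTmono
  rw [← hμ] at hSEL
  set U : Set (BondConfig (Fin n)) := ⋃ a ∈ A, (openConn o a : Set (BondConfig (Fin n))) with hU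
  set V : Fin n → Set (BondConfig (Fin n)) := fun a =>
    {ω : BondConfig (Fin n) | ω ∈ openConn o a ∧
      ∀ x ∈ A, ω ∈ openConn o x → (δ x < δ a ∨ (δ x = δ a ∧ a ≤ x))} with hV
  change μ.real (U ∩ {ω : BondConfig (Fin n) | ¬ T (openCluster ω o)}) ≤ ∑ a ∈ A, μ.real (V a) * δ a at hSEL
  -- left-hand side: `{1 ≤ N ≤ j} = U ∩ {¬T(C_o)}`
  have hL : {ω : BondConfig (Fin n) | 1 ≤ (A.filter fun x => ω ∈ openConn o x).card ∧
      (A.filter fun x => ω ∈ openConn o x).card ≤ j} = U ∩ {ω : BondConfig (Fin n) | ¬ T (openCluster ω o)} := by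
    ext ω
    rw [Set.mem_inter_iff, CIL.mem_iUnion_openConn_iff A o ω]
    simp only [Set.mem_setOf_eq, hT, not_lt, CIL.filter_mem_openCluster]
  -- right-hand side: `Σ_a μ(V_a) δ_a = Σ_B μ(π(o) = B) δ_{sel B}` (pointwise, then integrate)
  set P : Finset (Finset (Fin n)) := A.powerset.erase ∅ with hP
  have hpt : ∀ ω, (∑ a ∈ A, (V a).indicator (fun _ => δ a) ω) =
      ∑ B ∈ P, ({ω : BondConfig (Fin n) | (A.filter fun x => ω ∈ openConn o x) = B}).indicator
        (fun _ => δ (sel B)) ω := by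
    intro ω
    set B₀ := A.filter fun x => ω ∈ openConn o x with hB₀
    by_cases hne : B₀.Nonempty
    · -- `ω ∈ U`; the unique worst relay of `B₀` is `sel B₀`
      have hB₀P : B₀ ∈ P := by
        refine Finset.mem_erase.2 ⟨Finset.nonempty_iff_ne_empty.1 hne, Finset.mem_powerset.2 (Finset.filter_subset _ _)⟩
      obtain ⟨hselB, hselW⟩ := hsel_spec B₀ hne
      have hselA : sel B₀ ∈ A := (Finset.mem_filter.1 hselB).1
      have hωV : ω ∈ V (sel B₀) := ⟨(Finset.mem_filter.1 hselB).2,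
        fun x hx hox => hselW x (Finset.mem_filter.2 ⟨hx, hox⟩)⟩
      rw [Finset.sum_eq_single_of_mem (sel B₀) hselA, Set.indicator_of_mem hωV,
        Finset.sum_eq_single_of_mem B₀ hB₀P, Set.indicator_of_mem (show ω ∈ {ω : BondConfig (Fin n) |
          (A.filter fun x => ω ∈ openConn o x) = B₀} from rfl)]
      · intro B hB hBne
        exact Set.indicator_of_notMem (fun h => hBne (h.symm.trans rfl)) _
      · intro b hb hbs
        refine Set.indicator_of_notMem (fun hωb => hbs ?_) _
        have hbB : b ∈ B₀ := Finset.mem_filter.2 ⟨hb, hωb.1⟩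
        exact worst_unique δ B₀ hbB hselB
          (fun x hx => hωb.2 x (Finset.mem_filter.1 hx).1 (Finset.mem_filter.1 hx).2) hselW
    · -- `ω ∉ U`: both sides vanish
      have hB₀e : B₀ = ∅ := Finset.not_nonempty_iff_eq_empty.1 hne
      have h1 : ∀ a ∈ A, (V a).indicator (fun _ => δ a) ω = 0 := by
        intro a ha
        refine Set.indicator_of_notMem (fun hωa => hne ⟨a, Finset.mem_filter.2 ⟨ha, hωa.1⟩⟩) _
      have h2 : ∀ B ∈ P, ({ω : BondConfig (Fin n) | (A.filter fun x => ω ∈ openConn o x) = B}).indicator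
          (fun _ => δ (sel B)) ω = 0 := by
        intro B hB
        refine Set.indicator_of_notMem (fun h => ?_) _
        have hBe : B = ∅ := by rw [← (show B₀ = B from h), hB₀e]
        exact (Finset.mem_erase.1 hB).1 hBe
      rw [Finset.sum_congr rfl h1, Finset.sum_congr rfl h2, Finset.sum_const_zero, Finset.sum_const_zero]
  have hRHS : (∑ a ∈ A, μ.real (V a) * δ a) =
      ∑ B ∈ P, μ.real {ω : BondConfig (Fin n) | (A.filter fun x => ω ∈ openConn o x) = B} * δ (sel B) := by
    rw [← integral_sum_indicator μ A δ V, ← integral_sum_indicator' μ P (fun B => δ (sel B))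
      (fun B => {ω : BondConfig (Fin n) | (A.filter fun x => ω ∈ openConn o x) = B})]
    exact integral_congr_ae (Filter.Eventually.of_forall hpt)
  rw [hL]
  refine hSEL.trans (le_of_eq ?_)
  rw [hRHS]
  refine Finset.sum_congr rfl fun B _ => ?_
  rw [hδR (sel B)]

end CSLHolds

end Summit.CriticalPhenomena.PercolationContinuityZ3.Theorems

end
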